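import Mathlib
import HarnessLib
import Summits.QuantumFields.QCD.Theses.SpectralDefectExtinction

/-!
# Glue of the typed split of the crux `TipPricing` (stmt-QuantumFields-8967) — crux workfile `Cruxes/TipPricing/TipPricingSplit.lean`

Strategist unit `cstrat-stmt-QuantumFields-8967-p1` (2026-08-17).  Sorry-free; axioms `propext`, `Classical.choice`, `Quot.sound`.
Used as `--glue-by Summit.QuantumFields.QCD.Cruxes.TipPricing.CleanEdgeSplit.tipPricing_of_subs` for
`ledger route edit route-QuantumFields-SpectralDefectExtinction --split TipPricing --into {TightCleanEdge, CoercivityPricing}`.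
Companion prose: `Cruxes/TipPricing/STRATEGY-CENSUS.md` §Decomposition.

Crux-strategist decomposition (route `SpectralDefectExtinction`, rev ≥ 9 text of `WindowExtinction` = SD⁺:
mass scaling, asymptotic scaling, polynomial volume cap, branch, EXTINCT (a)+(b), TIGHT⁺).
`TipPricing := TipNoBinding → WegnerEstimate → WindowExtinction` is split into two children whose statements
are written out verbatim in the binders of `tipPricing_of_subs` below (they become the route items
`TightCleanEdge` and `CoercivityPricing` of the split; this file deliberately defines no `Prop`):

* child 1, the TRUNK ("tight clean edge"): for `N_f ∈ {2,3}` a mass-scaling, asymptotically scaling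
  Wilson regularisation of MINIMAL VOLUME GROWTH (`L_k ^ q ≤ a_k⁻¹ ^ (q+1)` eventually, for every `q ≥ 1`,
  i.e. `L_k = a_k^{-1-o(1)}`), on the physical branch (`-1 < m_crit(k)` eventually), with a threshold
  `M₀ ≥ 0` above which, for every mass tuple, (EXTINCT (a)) the phase-quenched expected number of real
  eigenvalues of the massless `r = 1` Wilson–Dirac operator below every running bare mass is `≤ ε` per scheme
  torus on all tori at least the scheme's, eventually in `k`, and (TIGHT⁺, verbatim) the phase-quenched mean
  absolute spectral index just past the line is `≥ max 1 (η (a_k(2L_k+1))²)`.  No Hermitian coercivity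
  window and no window constant.
* child 2, the WEGNER LEAF ("coercivity pricing"): `WegnerEstimate →` for EVERY such regularisation and
  threshold `M₀` at which EXTINCT (a) and TIGHT⁺ hold for all `m > M₀`, there are `M₁ ≥ M₀` and `c > 0` such
  that the full EXTINCT clause (a)+(b) of `WindowExtinction` (verbatim: real modes below the running mass
  plus eigenvalues of `γ₅ D_W(U, m_f(k), 1)` in the window `(-c a_k m_f/Z_k, c a_k m_f/Z_k)`) holds for all
  `m > M₁`.

The glue is logic: feed the trunk's witness to the leaf, raise the threshold to `M₁`, restrict TIGHT⁺ to probes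
`M > M₁ ≥ M₀`, and read the cap exponent `p = 2` of SD⁺ off minimal growth at `q = 1`.  `TipNoBinding`
(proved, item 8965) is discarded; `WegnerEstimate` is consumed by the leaf.
-/

open scoped BigOperators Topology
open Filter MeasureTheory
open Literature.MathematicalPhysics.QuantumLattice Literature.MathematicalPhysics.QuantumFieldTheory
  Literature.Probability.LatticeModels
open Summit.QuantumFields.QCD.Theses.SpectralDefectExtinction

namespace Summit.QuantumFields.QCD.Cruxes.TipPricing.CleanEdgeSplit

/-- **Split glue for `TipPricing`**: (child 1: a minimal-growth, branched, scaling regularisation whose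
line is a clean tight edge — EXTINCT (a) ∧ TIGHT⁺ above `M₀`) → (child 2: `WegnerEstimate` prices the
coercivity window at every clean tight edge — full EXTINCT (a)+(b) above some `M₁ ≥ M₀` with some `c > 0`)
→ `TipPricing`.  Pure logic over the verbatim clause texts of the route's `WindowExtinction`. -/
theorem tipPricing_of_subs
    (hT : ∀ Nf : ℕ, (Nf = 2 ∨ Nf = 3) → ∃ reg : QCDRegularisation Nf, reg.HasMassScaling ∧ (reg.scheme 0 0 0).HasAsymptoticScaling ∧ (∀ q : ℕ, 0 < q → ∀ᶠ k : ℕ in Filter.atTop, (reg.L k : ℝ) ^ q ≤ (reg.a k)⁻¹ ^ (q + 1)) ∧ (∀ᶠ k : ℕ in Filter.atTop, -1 < reg.mcrit k) ∧ ∃ M₀ : ℝ, 0 ≤ M₀ ∧ ∀ m : Fin Nf → ℝ, (∀ f, M₀ < m f) → (∀ ε : ℝ, 0 < ε → ∀ᶠ k : ℕ in Filter.atTop, ∀ S : ℕ, reg.L k ≤ S → (∫ U, (∑ f : Fin Nf, (Multiset.countP (fun z : ℂ => z.im = 0 ∧ z.re < -(reg.mcrit k + reg.a k * m f / reg.Zm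 k)) (wilsonDirac (fundamentalRep (Fin 3)) U 0 1).charpoly.roots : ℝ)) * ∏ f : Fin Nf, ‖fermionDet (wilsonDirac (fundamentalRep (Fin 3)) U (reg.mcrit k + reg.a k * m f / reg.Zm k) 1)‖ ∂(wilsonMeasure (d := 4) (L := 2 * S + 1) (fundamentalRep (Fin 3)) (reg.β k))) / (∫ U, ∏ f : Fin Nf, ‖fermionDet (wilsonDirac (fundamentalRep (Fin 3)) U (reg.mcrit k + reg.a k * m f / reg.Zm k) 1)‖ ∂(wilsonMeasure (d := 4) (L := 2 * S + 1) (fundamentalRep (Fin 3)) (reg.β k))) ≤ ε * ((2 * S + 1 : ℝ) / (2 * reg.L k + 1)) ^ 4) ∧ (∃ η : ℝ, 0 < η ∧ ∀ M : ℝ, M₀ < M → ∀ᶠ k : ℕ in Filter.atTop, max 1 (η * (reg.a k * (2 * reg.L k + 1 : ℝ)) ^ 2) ≤ (∫ U, (|(Multiset.countP (fun z : ℂ => z.re < 0) (spinorLift gammaFive * wilsonDirac (fundamentalRep (Fin 3)) U (reg.mcrit k - reg.a k * M / reg.Zm k) 1).charpoly.roots : ℝ) - 6 * (2 * reg.L k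 + 1 : ℝ) ^ 4|) * ∏ f : Fin Nf, ‖fermionDet (wilsonDirac (fundamentalRep (Fin 3)) U (reg.mcrit k + reg.a k * m f / reg.Zm k) 1)‖ ∂(wilsonMeasure (d := 4) (L := 2 * reg.L k + 1) (fundamentalRep (Fin 3)) (reg.β k))) / (∫ U, ∏ f : Fin Nf, ‖fermionDet (wilsonDirac (fundamentalRep (Fin 3)) U (reg.mcrit k + reg.a k * m f / reg.Zm k) 1)‖ ∂(wilsonMeasure (d := 4) (L := 2 * reg.L k + 1) (fundamentalRep (Fin 3)) (reg.β k)))))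
    (hB : WegnerEstimate → ∀ Nf : ℕ, (Nf = 2 ∨ Nf = 3) → ∀ reg : QCDRegularisation Nf, reg.HasMassScaling → (reg.scheme 0 0 0).HasAsymptoticScaling → (∀ q : ℕ, 0 < q → ∀ᶠ k : ℕ in Filter.atTop, (reg.L k : ℝ) ^ q ≤ (reg.a k)⁻¹ ^ (q + 1)) → (∀ᶠ k : ℕ in Filter.atTop, -1 < reg.mcrit k) → ∀ M₀ : ℝ, 0 ≤ M₀ → (∀ m : Fin Nf → ℝ, (∀ f, M₀ < m f) → (∀ ε : ℝ, 0 < ε → ∀ᶠ k : ℕ in Filter.atTop, ∀ S : ℕ, reg.L k ≤ S → (∫ U, (∑ f : Fin Nf, (Multiset.countP (fun z : ℂ => z.im = 0 ∧ z.re < -(reg.mcrit k + reg.a k * m f / reg.Zm k)) (wilsonDirac (fundamentalRep (Fin 3)) U 0 1).charpoly.roots : ℝ)) * ∏ f : Fin Nf, ‖fermionDet (wilsonDirac (fundamentalRep (Fin 3)) U (reg.mcrit k + reg.a k * m f / reg.Zm k) 1)‖ ∂(wilsonMeasure (d := 4) (L := 2 * S + 1) (fundamentalRep (Fin 3)) (reg.β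 k))) / (∫ U, ∏ f : Fin Nf, ‖fermionDet (wilsonDirac (fundamentalRep (Fin 3)) U (reg.mcrit k + reg.a k * m f / reg.Zm k) 1)‖ ∂(wilsonMeasure (d := 4) (L := 2 * S + 1) (fundamentalRep (Fin 3)) (reg.β k))) ≤ ε * ((2 * S + 1 : ℝ) / (2 * reg.L k + 1)) ^ 4) ∧ (∃ η : ℝ, 0 < η ∧ ∀ M : ℝ, M₀ < M → ∀ᶠ k : ℕ in Filter.atTop, max 1 (η * (reg.a k * (2 * reg.L k + 1 : ℝ)) ^ 2) ≤ (∫ U, (|(Multiset.countP (fun z : ℂ => z.re < 0) (spinorLift gammaFive * wilsonDirac (fundamentalRep (Fin 3)) U (reg.mcrit k - reg.a k * M / reg.Zm k) 1).charpoly.roots : ℝ) - 6 * (2 * reg.L k + 1 : ℝ) ^ 4|) * ∏ f : Fin Nf, ‖fermionDet (wilsonDirac (fundamentalRep (Fin 3)) U (reg.mcrit k + reg.a k * m f / reg.Zm k) 1)‖ ∂(wilsonMeasure (d := 4) (L := 2 * reg.L k + 1) (fundamentalRep (Fin 3)) (reg.β k))) / (∫ U, ∏ f : Fin Nf, ‖fermionDet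 (wilsonDirac (fundamentalRep (Fin 3)) U (reg.mcrit k + reg.a k * m f / reg.Zm k) 1)‖ ∂(wilsonMeasure (d := 4) (L := 2 * reg.L k + 1) (fundamentalRep (Fin 3)) (reg.β k))))) → ∃ M₁ : ℝ, M₀ ≤ M₁ ∧ ∃ c : ℝ, 0 < c ∧ ∀ m : Fin Nf → ℝ, (∀ f, M₁ < m f) → (∀ ε : ℝ, 0 < ε → ∀ᶠ k : ℕ in Filter.atTop, ∀ S : ℕ, reg.L k ≤ S → (∫ U, ((∑ f : Fin Nf, ((Multiset.countP (fun z : ℂ => z.im = 0 ∧ z.re < -(reg.mcrit k + reg.a k * m f / reg.Zm k)) (wilsonDirac (fundamentalRep (Fin 3)) U 0 1).charpoly.roots : ℝ) + (Multiset.countP (fun z : ℂ => |z.re| < c * (reg.a k * m f / reg.Zm k)) (spinorLift gammaFive * wilsonDirac (fundamentalRep (Fin 3)) U (reg.mcrit k + reg.a k * m f / reg.Zm k) 1).charpoly.roots : ℝ)))) * ∏ f : Fin Nf, ‖fermionDet (wilsonDirac (fundamentalRep (Fin 3)) U (reg.mcrit k + reg.a k * m f / reg.Zm k) 1)‖ ∂(wilsonMeasure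 (d := 4) (L := 2 * S + 1) (fundamentalRep (Fin 3)) (reg.β k))) / (∫ U, ∏ f : Fin Nf, ‖fermionDet (wilsonDirac (fundamentalRep (Fin 3)) U (reg.mcrit k + reg.a k * m f / reg.Zm k) 1)‖ ∂(wilsonMeasure (d := 4) (L := 2 * S + 1) (fundamentalRep (Fin 3)) (reg.β k))) ≤ ε * ((2 * S + 1 : ℝ) / (2 * reg.L k + 1)) ^ 4)) :
    TipPricing := by
  intro _ hW Nf hNf
  obtain ⟨reg, hms, has, hgr, hbr, M₀, hM₀, hTm⟩ := hT Nf hNf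
  obtain ⟨M₁, hM₀₁, c, hc, hE⟩ := hB hW Nf hNf reg hms has hgr hbr M₀ hM₀ hTm
  refine ⟨reg, hms, has, ⟨2, ?_⟩, hbr, M₁, le_trans hM₀ hM₀₁, c, hc, fun m hm => ⟨hE m hm, ?_⟩⟩
  · filter_upwards [hgr 1 one_pos] with k hk
    simpa using hk
  · have hm' : ∀ f, M₀ < m f := fun f => lt_of_le_of_lt hM₀₁ (hm f)
    obtain ⟨η, hη, hT'⟩ := (hTm m hm').2
    exact ⟨η, hη, fun M hM => hT' M (lt_of_le_of_lt hM₀₁ hM)⟩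

end Summit.QuantumFields.QCD.Cruxes.TipPricing.CleanEdgeSplit
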